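import Summits.KontsevichZagierPeriods.Zeta5Search.WedgeDictionaryLevelDescentFaceU
import Summits.KontsevichZagierPeriods.Zeta5Search.WedgeDictionaryLevelDescentFaceExt
import HarnessLib

/-!
# The `ζ(5)`-coefficient `U(b)` on the extended face `b₁ + b₂ = N`: pole structure (cell `pub-zeta5`, gen-1 g7)

HONEST FRAMING: systematic search; no irrationality claim unless certified.

P1's mechanism (`…LevelDescentFaceU`: `U(b) = Σ_p c_{4,p}`, `pf_top_coeffs`) run on the whole hyperplane `b₁ + b₂ = N`
(P1 did `b₁ = b₂`).  With `D = (X)_{N+1}`, `G = (X+β₁)(X+β₂)`, `Q₅ = ∏_{j=3}^{7}` (slot factors) the numerator satisfies the uniform identity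
`numPoly b · G = (2X+N) · D² · Q₅` (`numPoly_mul_faceFactor`, the slot regrouping of `…LevelDescentFaceExt`).  Differentiating it up to three
times at a pole `−p` (`jets_of_mul_eq`) gives: `numPoly b(−p) = 0` for every `p ≤ N`; `numPoly b′(−p) = 0` for `p ∉ {β₁, β₂}`;
`numPoly b′(−βᵢ) = κ · Q₅(−βᵢ) · D′(−βᵢ)²` with `κ = 2` if `β₁ = β₂` and `κ = 1` otherwise (`numPoly_face_jets`).  Hence `c_{5,p} = 0`,
`c_{4,p} = 0` off `{β₁, β₂}` and (`coeffU_faceExt_poles`)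
  `U(b) = 2·Q₅(−β₁)/D′(−β₁)⁴`  (`β₁ = β₂`),   `U(b) = Q₅(−β₁)/D′(−β₁)⁴ + Q₅(−β₂)/D′(−β₂)⁴`  (`β₁ ≠ β₂`),
`D′(−p) = ∏_{s ≤ N, s ≠ p} (s − p)`.  The factorial evaluation (`= faceValue b`) is in `…LevelDescentFaceUValue`.
No irrationality content.
-/

open Finset Polynomial

namespace Summit.KontsevichZagierPeriods.Zeta5Search.WedgeDictionary

open Summit.KontsevichZagierPeriods.Zeta5Search.DualSeries
open Summit.KontsevichZagierPeriods.Zeta5Search.BigPrime (e0Z ER e0Z_ne_zero)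
open Literature.NumberTheory.Transcendental.BallRivoal (pochPoly eval_pochPoly poch)

namespace LevelDescent

/-! ### Calculus at a double root -/

/-- Jets of `F` at `x` from `F·G = K·D²` with `D(x) = 0` (orders 0–3). -/
theorem jets_of_mul_eq (F G K D : ℚ[X]) (x : ℚ) (h : F * G = K * (D * D)) (hD : D.eval x = 0) :
    F.eval x * G.eval x = 0 ∧
    (derivative F).eval x * G.eval x + F.eval x * (derivative G).eval x = 0 ∧
    (derivative (derivative F)).eval x * G.eval x + 2 * (derivative F).eval x * (derivative G).eval x +
        F.eval x * (derivative (derivative G)).eval x = 2 * K.eval x * (derivative D).eval x ^ 2 ∧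
    (derivative (derivative (derivative F))).eval x * G.eval x +
        3 * (derivative (derivative F)).eval x * (derivative G).eval x +
        3 * (derivative F).eval x * (derivative (derivative G)).eval x +
        F.eval x * (derivative (derivative (derivative G))).eval x =
      6 * (derivative K).eval x * (derivative D).eval x ^ 2 +
        6 * K.eval x * (derivative D).eval x * (derivative (derivative D)).eval x := by
  have h0 := congrArg (eval x) h
  have h1 := congrArg (fun P => (derivative P).eval x) h
  have h2 := congrArg (fun P => (derivative (derivative P)).eval x) h
  have h3 := congrArg (fun P => (derivative (derivative (derivative P))).eval x) h
  simp only [derivative_mul, derivative_add, eval_mul, eval_add] at h0 h1 h2 h3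
  rw [hD] at h0 h1 h2 h3
  refine ⟨by linear_combination h0, by linear_combination h1, by linear_combination h2, by linear_combination h3⟩

/-- Jets of the face factor `G = (X + a)(X + c)`. -/
theorem faceFactor_jets (a c x : ℚ) :
    ((X + C a) * (X + C c)).eval x = (x + a) * (x + c) ∧
    (derivative ((X + C a) * (X + C c))).eval x = 2 * x + a + c ∧
    (derivative (derivative ((X + C a) * (X + C c)))).eval x = 2 ∧
    (derivative (derivative (derivative ((X + C a) * (X + C c))))).eval x = 0 := by
  refine ⟨?_, ?_, ?_, ?_⟩ <;> simp [derivative_mul] <;> ring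

/-- Jets of `K = (2X + n)·Q` (orders 0, 1). -/
theorem linFactor_jets (n : ℚ) (Q : ℚ[X]) (x : ℚ) :
    ((C (2 : ℚ) * X + C n) * Q).eval x = (2 * x + n) * Q.eval x ∧
    (derivative ((C (2 : ℚ) * X + C n) * Q)).eval x = 2 * Q.eval x + (2 * x + n) * (derivative Q).eval x := by
  constructor <;> simp [derivative_mul]

/-! ### `D = (X)_{N+1}` at the poles -/

/-- `D(−p) = 0` for `p ≤ n`. -/
theorem pochPoly0_eval_neg {n p : ℕ} (hp : p ≤ n) : (pochPoly 0 (n + 1)).eval (-(p : ℚ)) = 0 := by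
  unfold pochPoly
  rw [eval_prod]
  exact prod_eq_zero (mem_range.2 (Nat.lt_succ_of_le hp)) (by simp)

/-- `D = (X + p) · ∏_{s ≤ n, s ≠ p} (X + s)`. -/
theorem pochPoly0_split_erase {n p : ℕ} (hp : p ≤ n) :
    pochPoly 0 (n + 1) = (X + C (p : ℚ)) * ∏ s ∈ (range (n + 1)).erase p, (X + C (s : ℚ)) := by
  have e : pochPoly 0 (n + 1) = ∏ s ∈ range (n + 1), (X + C (s : ℚ)) := by
    unfold pochPoly; exact prod_congr rfl fun s _ => by rw [zero_add]
  rw [e, ← mul_prod_erase (range (n + 1)) (fun s => X + C (s : ℚ)) (mem_range.2 (Nat.lt_succ_of_le hp))]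

/-- `D′(−p) = ∏_{s ≤ n, s ≠ p} (s − p)`. -/
def dval (n p : ℕ) : ℚ := ∏ s ∈ (range (n + 1)).erase p, ((s : ℚ) - p)

/-- `D′(−p) = dval n p`. -/
theorem derivative_pochPoly0_eval_neg {n p : ℕ} (hp : p ≤ n) :
    (derivative (pochPoly 0 (n + 1))).eval (-(p : ℚ)) = dval n p := by
  rw [pochPoly0_split_erase hp, derivative_mul, eval_add, eval_mul, eval_mul]
  have h1 : derivative (X + C (p : ℚ)) = 1 := by simp
  have h2 : (X + C (p : ℚ)).eval (-(p : ℚ)) = 0 := by simp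
  rw [h1, h2, eval_one, one_mul, zero_mul, add_zero, eval_prod, dval]
  exact prod_congr rfl fun s _ => by simp only [eval_add, eval_X, eval_C]; ring

/-- `e₀(p) = dval⁶`. -/
theorem e0Z_eq_dval_pow (n p : ℕ) : ((e0Z n p : ℤ) : ℚ) = dval n p ^ 6 := by
  rw [e0Z, dval, ← prod_pow]; push_cast; rfl

/-- `dval ≠ 0`. -/
theorem dval_ne_zero (n p : ℕ) : dval n p ≠ 0 := by
  intro h
  have := e0Z_eq_dval_pow n p
  rw [h, zero_pow (by norm_num)] at this
  exact e0Z_ne_zero n p (by exact_mod_cast this)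

/-! ### The numerator on the extended face -/

/-- The slot factor `Q₅ = ∏_{j=3}^{7} (X)_{b_j} (X + N − b_j + 1)_{b_j}`. -/
noncomputable def Q5 (b : ℕ → ℤ) : ℚ[X] :=
  ∏ k ∈ range 5, pochPoly 0 (b (k + 1 + 1 + 1)).toNat * pochPoly ((b 0 - b (k + 1 + 1 + 1) + 1 : ℤ) : ℚ) (b (k + 1 + 1 + 1)).toNat

/-- **`numPoly b · (X+β₁)(X+β₂) = (2X+N)·D²·Q₅`** on `b₁ + b₂ = N`. -/
theorem numPoly_mul_faceFactor (b : ℕ → ℤ) (h1 : 0 ≤ b 1) (h2 : 0 ≤ b 2) (h12 : b 1 + b 2 = b 0) :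
    numPoly b * ((X + C (((b 1).toNat : ℕ) : ℚ)) * (X + C (((b 2).toNat : ℕ) : ℚ))) =
      (C (2 : ℚ) * X + C (b 0 : ℚ)) * (pochPoly 0 ((b 1).toNat + (b 2).toNat + 1) * pochPoly 0 ((b 1).toNat + (b 2).toNat + 1)) *
        Q5 b := by
  set β₁ := (b 1).toNat with hβ₁
  set β₂ := (b 2).toNat with hβ₂
  have hz1 : ((β₁ : ℕ) : ℤ) = b 1 := Int.toNat_of_nonneg h1
  have hz2 : ((β₂ : ℕ) : ℤ) = b 2 := Int.toNat_of_nonneg h2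
  have e01 : ((b 0 - b (0 + 1) + 1 : ℤ) : ℚ) = (β₂ : ℚ) + 1 := by
    have : (b 0 - b (0 + 1) + 1 : ℤ) = (β₂ : ℤ) + 1 := by simp only [zero_add]; omega
    rw [this]; push_cast; ring
  have e02 : ((b 0 - b (1 + 1) + 1 : ℤ) : ℚ) = (β₁ : ℚ) + 1 := by
    have : (b 0 - b (1 + 1) + 1 : ℤ) = (β₁ : ℤ) + 1 := by rw [show (1 : ℕ) + 1 = 2 from rfl]; omega
    rw [this]; push_cast; ring
  have hA : pochPoly 0 β₁ * (X + C (β₁ : ℚ)) * pochPoly ((β₁ : ℚ) + 1) β₂ = pochPoly 0 (β₁ + β₂ + 1) := by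
    rw [show β₁ + β₂ + 1 = β₁ + (β₂ + 1) by ring, pochPoly_zero_add β₁ (β₂ + 1), pochPoly_succ_left]; ring
  have hB : pochPoly 0 β₂ * (X + C (β₂ : ℚ)) * pochPoly ((β₂ : ℚ) + 1) β₁ = pochPoly 0 (β₁ + β₂ + 1) := by
    rw [show β₁ + β₂ + 1 = β₂ + (β₁ + 1) by ring, pochPoly_zero_add β₂ (β₁ + 1), pochPoly_succ_left]; ring
  have hAB : pochPoly 0 β₁ * pochPoly ((β₂ : ℚ) + 1) β₁ * (pochPoly 0 β₂ * pochPoly ((β₁ : ℚ) + 1) β₂) *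
      ((X + C (β₁ : ℚ)) * (X + C (β₂ : ℚ))) = pochPoly 0 (β₁ + β₂ + 1) * pochPoly 0 (β₁ + β₂ + 1) := by
    calc _ = (pochPoly 0 β₁ * (X + C (β₁ : ℚ)) * pochPoly ((β₁ : ℚ) + 1) β₂) *
          (pochPoly 0 β₂ * (X + C (β₂ : ℚ)) * pochPoly ((β₂ : ℚ) + 1) β₁) := by ring
      _ = _ := by rw [hA, hB]
  have hsplit : ∀ F : ℕ → ℚ[X], ∏ j ∈ range 7, F j = F 0 * F (0 + 1) * ∏ k ∈ range 5, F (k + 1 + 1) := by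
    intro F; rw [prod_range_succ' _ 6, prod_range_succ' _ 5]; ring
  unfold numPoly Q5
  rw [hsplit, show (b (0 + 1)).toNat = β₁ from rfl, show (b (1 + 1)).toNat = β₂ from rfl, e01, e02]
  linear_combination ((C (2 : ℚ) * X + C (b 0 : ℚ)) *
    ∏ k ∈ range 5, pochPoly 0 (b (k + 1 + 1 + 1)).toNat *
      pochPoly ((b 0 - b (k + 1 + 1 + 1) + 1 : ℤ) : ℚ) (b (k + 1 + 1 + 1)).toNat) * hAB

/-- **Jets of the numerator on the extended face.** With `N = β₁ + β₂`, `D = (X)_{N+1}`: `numPoly b(−p) = 0` (`p ≤ N`);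
`numPoly b′(−p) = 0` (`p ≤ N`, `p ∉ {β₁,β₂}`); `numPoly b′(−β₁) = κ·Q₅(−β₁)·dval²`, `numPoly b′(−β₂) = κ·Q₅(−β₂)·dval²`. -/
theorem numPoly_face_jets (b : ℕ → ℤ) (h1 : 0 ≤ b 1) (h2 : 0 ≤ b 2) (h12 : b 1 + b 2 = b 0) :
    let β₁ := (b 1).toNat; let β₂ := (b 2).toNat
    (∀ p, p ≤ β₁ + β₂ → (numPoly b).eval (-(p : ℚ)) = 0) ∧
    (∀ p, p ≤ β₁ + β₂ → p ≠ β₁ → p ≠ β₂ → (derivative (numPoly b)).eval (-(p : ℚ)) = 0) ∧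
    (derivative (numPoly b)).eval (-(β₁ : ℚ)) =
      (if β₁ = β₂ then 2 else 1) * (Q5 b).eval (-(β₁ : ℚ)) * dval (β₁ + β₂) β₁ ^ 2 ∧
    (derivative (numPoly b)).eval (-(β₂ : ℚ)) =
      (if β₁ = β₂ then 2 else 1) * (Q5 b).eval (-(β₂ : ℚ)) * dval (β₁ + β₂) β₂ ^ 2 := by
  intro β₁ β₂
  have hstar := numPoly_mul_faceFactor b h1 h2 h12
  have hN : ((b 0 : ℤ) : ℚ) = (β₁ : ℚ) + β₂ := by
    have : (b 0 : ℤ) = (β₁ : ℤ) + β₂ := by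
      have hz1 : ((β₁ : ℕ) : ℤ) = b 1 := Int.toNat_of_nonneg h1
      have hz2 : ((β₂ : ℕ) : ℤ) = b 2 := Int.toNat_of_nonneg h2
      omega
    rw [this]; push_cast; ring
  rw [hN] at hstar
  -- the jets at a pole `-p`
  have J : ∀ p, p ≤ β₁ + β₂ →
      let F0 := (numPoly b).eval (-(p : ℚ)); let F1 := (derivative (numPoly b)).eval (-(p : ℚ))
      let F2 := (derivative (derivative (numPoly b))).eval (-(p : ℚ))
      let q := (Q5 b).eval (-(p : ℚ)); let q' := (derivative (Q5 b)).eval (-(p : ℚ)); let d := dval (β₁ + β₂) p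
      let g0 := (-(p : ℚ) + β₁) * (-(p : ℚ) + β₂); let g1 := 2 * (-(p : ℚ)) + β₁ + β₂
      F0 * g0 = 0 ∧ F1 * g0 + F0 * g1 = 0 ∧ F2 * g0 + 2 * F1 * g1 + F0 * 2 = 2 * (g1 * q) * d ^ 2 ∧
        (∃ F3 D2 : ℚ, F3 * g0 + 3 * F2 * g1 + 3 * F1 * 2 + F0 * 0 = 6 * (2 * q + g1 * q') * d ^ 2 + 6 * (g1 * q) * d * D2) := by
    intro p hp
    have hj := jets_of_mul_eq (numPoly b) ((X + C (β₁ : ℚ)) * (X + C (β₂ : ℚ)))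
      ((C (2 : ℚ) * X + C ((β₁ : ℚ) + β₂)) * Q5 b) (pochPoly 0 (β₁ + β₂ + 1)) (-(p : ℚ))
      (by rw [hstar]; ring) (pochPoly0_eval_neg hp)
    obtain ⟨g0e, g1e, g2e, g3e⟩ := faceFactor_jets (β₁ : ℚ) (β₂ : ℚ) (-(p : ℚ))
    obtain ⟨k0e, k1e⟩ := linFactor_jets ((β₁ : ℚ) + β₂) (Q5 b) (-(p : ℚ))
    rw [g0e, g1e, g2e, g3e, k0e, k1e, derivative_pochPoly0_eval_neg hp] at hj
    obtain ⟨j0, j1, j2, j3⟩ := hj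
    exact ⟨by linear_combination j0, by linear_combination j1, by linear_combination j2,
      ⟨(derivative (derivative (derivative (numPoly b)))).eval (-(p : ℚ)),
        (derivative (derivative (pochPoly 0 (β₁ + β₂ + 1)))).eval (-(p : ℚ)), by linear_combination j3⟩⟩
  refine ⟨?_, ?_, ?_, ?_⟩
  · -- values
    intro p hp
    obtain ⟨j0, j1, j2, -⟩ := J p hp
    by_cases hg0 : (-(p : ℚ) + β₁) * (-(p : ℚ) + β₂) = 0
    · by_cases hg1 : 2 * (-(p : ℚ)) + β₁ + β₂ = 0
      · rw [hg0, hg1] at j2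
        linear_combination j2 / 2
      · rw [hg0] at j1
        exact (mul_eq_zero.1 (by linear_combination j1)).resolve_right hg1
    · exact (mul_eq_zero.1 j0).resolve_right hg0
  · -- derivative off the two poles
    intro p hp hp1 hp2
    obtain ⟨j0, j1, -, -⟩ := J p hp
    have hg0 : (-(p : ℚ) + β₁) * (-(p : ℚ) + β₂) ≠ 0 := by
      refine mul_ne_zero ?_ ?_
      · intro h; apply hp1; exact_mod_cast (by linarith : (p : ℚ) = β₁)
      · intro h; apply hp2; exact_mod_cast (by linarith : (p : ℚ) = β₂)
    have hF0 : (numPoly b).eval (-(p : ℚ)) = 0 := (mul_eq_zero.1 j0).resolve_right hg0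
    rw [hF0, zero_mul, add_zero] at j1
    exact (mul_eq_zero.1 j1).resolve_right hg0
  · -- derivative at -β₁
    obtain ⟨j0, j1, j2, F3, D2, j3⟩ := J β₁ (by omega)
    have hg0 : (-(β₁ : ℚ) + β₁) * (-(β₁ : ℚ) + β₂) = 0 := by ring
    by_cases he : β₁ = β₂
    · rw [if_pos he]
      have hg1 : 2 * (-(β₁ : ℚ)) + β₁ + β₂ = 0 := by rw [he]; ring
      rw [hg0, hg1] at j2 j3
      have hF0 : (numPoly b).eval (-(β₁ : ℚ)) = 0 := by linear_combination j2 / 2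
      rw [hF0] at j3
      linear_combination j3 / 6
    · rw [if_neg he]
      have hg1 : 2 * (-(β₁ : ℚ)) + β₁ + β₂ ≠ 0 := by
        intro h; apply he; exact_mod_cast (by linarith : (β₁ : ℚ) = β₂)
      rw [hg0] at j1 j2
      have hF0 : (numPoly b).eval (-(β₁ : ℚ)) = 0 := (mul_eq_zero.1 (by linear_combination j1)).resolve_right hg1
      rw [hF0] at j2
      have := mul_left_cancel₀ hg1 (show (2 * (-(β₁ : ℚ)) + β₁ + β₂) * (derivative (numPoly b)).eval (-(β₁ : ℚ)) =
        (2 * (-(β₁ : ℚ)) + β₁ + β₂) * (1 * (Q5 b).eval (-(β₁ : ℚ)) * dval (β₁ + β₂) β₁ ^ 2) by linear_combination j2 / 2)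
      exact this
  · -- derivative at -β₂
    obtain ⟨j0, j1, j2, F3, D2, j3⟩ := J β₂ (by omega)
    have hg0 : (-(β₂ : ℚ) + β₁) * (-(β₂ : ℚ) + β₂) = 0 := by ring
    by_cases he : β₁ = β₂
    · rw [if_pos he]
      have hg1 : 2 * (-(β₂ : ℚ)) + β₁ + β₂ = 0 := by rw [he]; ring
      rw [hg0, hg1] at j2 j3
      have hF0 : (numPoly b).eval (-(β₂ : ℚ)) = 0 := by linear_combination j2 / 2
      rw [hF0] at j3
      linear_combination j3 / 6
    · rw [if_neg he]
      have hg1 : 2 * (-(β₂ : ℚ)) + β₁ + β₂ ≠ 0 := by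
        intro h; apply he; exact_mod_cast (by linarith : (β₁ : ℚ) = β₂)
      rw [hg0] at j1 j2
      have hF0 : (numPoly b).eval (-(β₂ : ℚ)) = 0 := (mul_eq_zero.1 (by linear_combination j1)).resolve_right hg1
      rw [hF0] at j2
      have := mul_left_cancel₀ hg1 (show (2 * (-(β₂ : ℚ)) + β₁ + β₂) * (derivative (numPoly b)).eval (-(β₂ : ℚ)) =
        (2 * (-(β₂ : ℚ)) + β₁ + β₂) * (1 * (Q5 b).eval (-(β₂ : ℚ)) * dval (β₁ + β₂) β₂ ^ 2) by linear_combination j2 / 2)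
      exact this

/-! ### The pole formula for `U(b)` on the extended face -/

/-- Pole formula: `U(b) = 2·Q₅(−β₁)/dval⁴` (`β₁ = β₂`), `U(b) = Q₅(−β₁)/dval(β₁)⁴ + Q₅(−β₂)/dval(β₂)⁴` (`β₁ ≠ β₂`), on the extended face. -/
def coeffU_facePoles_stmt : Prop :=
  ∀ b : ℕ → ℤ, 0 ≤ b 0 → (∀ j ∈ Icc 1 7, 0 ≤ b j ∧ b j ≤ b 0) → 0 ≤ dOf b → b 1 + b 2 = b 0 →
    coeffU b =
      if (b 1).toNat = (b 2).toNat then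
        2 * (Q5 b).eval (-(((b 1).toNat : ℕ) : ℚ)) / dval ((b 1).toNat + (b 2).toNat) (b 1).toNat ^ 4
      else
        (Q5 b).eval (-(((b 1).toNat : ℕ) : ℚ)) / dval ((b 1).toNat + (b 2).toNat) (b 1).toNat ^ 4 +
          (Q5 b).eval (-(((b 2).toNat : ℕ) : ℚ)) / dval ((b 1).toNat + (b 2).toNat) (b 2).toNat ^ 4

/-- Proof of the pole formula (`pf_top_coeffs` + `numPoly_face_jets`). -/
theorem coeffU_facePoles_holds : coeffU_facePoles_stmt := by
  intro b h0 hS hd h12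
  have h1 : 0 ≤ b 1 := (hS 1 (by simp)).1
  have h2 : 0 ≤ b 2 := (hS 2 (by simp)).1
  have hb : InBox b := by
    refine ⟨h0, fun j hj => ?_⟩
    have := hS (j + 1) (by simp only [mem_Icc]; have := mem_range.1 hj; omega)
    exact ⟨this.1, by omega⟩
  have hsum : ∑ j ∈ range 7, b (j + 1) ≤ 3 * b 0 + 1 := by unfold dOf at hd; omega
  obtain ⟨c, hc⟩ := exists_isPFData b hb hsum
  obtain ⟨β₁, e1⟩ : ∃ β₁ : ℕ, (b 1).toNat = β₁ := ⟨_, rfl⟩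
  obtain ⟨β₂, e2⟩ : ∃ β₂ : ℕ, (b 2).toNat = β₂ := ⟨_, rfl⟩
  have hN : (b 0).toNat = β₁ + β₂ := by omega
  obtain ⟨hval, hder, hd1, hd2⟩ := numPoly_face_jets b h1 h2 h12
  rw [e1, e2] at hval hder hd1 hd2
  rw [e1, e2]
  -- the top coefficients
  have he0 : ∀ p, ((e0Z (β₁ + β₂) p : ℤ) : ℚ) = dval (β₁ + β₂) p ^ 6 := fun p => e0Z_eq_dval_pow _ p
  have hdv : ∀ p, dval (β₁ + β₂) p ≠ 0 := fun p => dval_ne_zero _ p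
  have hc5 : ∀ p, p ≤ β₁ + β₂ → c 5 p = 0 := by
    intro p hp
    have h5 := (pf_top_coeffs b hc (q := p) (by omega)).1
    rw [hN, hval p hp, he0] at h5
    exact (mul_eq_zero.1 h5).resolve_right (pow_ne_zero 6 (hdv p))
  have hc4 : ∀ p, p ≤ β₁ + β₂ → c 4 p * dval (β₁ + β₂) p ^ 6 = (derivative (numPoly b)).eval (-(p : ℚ)) := by
    intro p hp
    have h4 := (pf_top_coeffs b hc (q := p) (by omega)).2
    rw [hN, hc5 p hp, zero_mul, add_zero, he0] at h4
    exact h4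
  have hc4z : ∀ p, p ≤ β₁ + β₂ → p ≠ β₁ → p ≠ β₂ → c 4 p = 0 := by
    intro p hp hp1 hp2
    have h4 := hc4 p hp
    rw [hder p hp hp1 hp2] at h4
    exact (mul_eq_zero.1 h4).resolve_right (pow_ne_zero 6 (hdv p))
  have hc41 : c 4 β₁ = (if β₁ = β₂ then 2 else 1) * (Q5 b).eval (-(β₁ : ℚ)) / dval (β₁ + β₂) β₁ ^ 4 := by
    have h4 := hc4 β₁ (by omega)
    have hd0 := hdv β₁
    rw [hd1] at h4
    rw [eq_div_iff (pow_ne_zero 4 hd0)]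
    exact mul_right_cancel₀ (pow_ne_zero 2 hd0) (by linear_combination h4)
  have hc42 : c 4 β₂ = (if β₁ = β₂ then 2 else 1) * (Q5 b).eval (-(β₂ : ℚ)) / dval (β₁ + β₂) β₂ ^ 4 := by
    have h4 := hc4 β₂ (by omega)
    have hd0 := hdv β₂
    rw [hd2] at h4
    rw [eq_div_iff (pow_ne_zero 4 hd0)]
    exact mul_right_cancel₀ (pow_ne_zero 2 hd0) (by linear_combination h4)
  rw [coeffU_eq hc, hN]
  by_cases he : β₁ = β₂
  · rw [if_pos he, sum_eq_single β₁, hc41, if_pos he]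
    · intro p hp hp1; exact hc4z p (Nat.lt_succ_iff.1 (mem_range.1 hp)) hp1 (he ▸ hp1)
    · intro hnot; exact absurd (mem_range.2 (by omega)) hnot
  · rw [if_neg he, sum_eq_add_of_mem β₁ β₂ (mem_range.2 (by omega)) (mem_range.2 (by omega)) he, hc41, hc42, if_neg he,
      one_mul, one_mul]
    intro p hp hne
    exact hc4z p (Nat.lt_succ_iff.1 (mem_range.1 hp)) hne.1 hne.2

end LevelDescent

end Summit.KontsevichZagierPeriods.Zeta5Search.WedgeDictionary
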